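import Summits.QuantumFields.YangMills.Theorems.BalabanUVNodesN15KingModelCombesThomasFormLipschitz
import HarnessLib

/-!
# BalabanUVNodes ∕ N15 — THE KING-MODEL RUNG (PART Ϧ-j): THE COMBES–THOMAS PACKAGE, BY NAME — decay of the full background propagator on the small-curvature class and at pure gauges,
# King's (4.34)(ii) for `Δ_eff(U)` at curved `U`, and the `η`-uniform Lipschitz dependence on the field, in one conjunction; «what the curved case adds» for [B9] Theorem 3.1's objects
# (Track A, DAG node N15 = NE2; FAN-OUT v1.1 §N15 s3 «KING-MODEL RUNG … + what the curved case adds»; count-neutral)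

HONEST FRAMING.  Count-neutral (cell `pub-ymgap`, seat `pub-ymgap-dag-n15-e` g50; `--supports stmt-QuantumFields-27247 --as helper` = K3ᴬ, KEY MAP v3).  A by-name assembly of PARTS Ϧ-c∕Ϧ-d∕Ϧ-e∕Ϧ-h;
King's one-level comparison model (comb contours, King's scaling `A₀(U) = L²(−Δ_U) + m² + aQ(U)^*Q(U)`), unitary link fields, any fibre; `ℓ²`-Combes–Thomas constants.  NOT Bałaban's
multi-level `G_k(U)`, random-walk expansion or analyticity; NOT a node discharge (N15 of record untouched); nothing continuum ∕ ℝ⁴ ∕ OS ∕ Clay.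

THE RESULTS: ★★★ **`king_combes_thomas_package`** (`a > 0`, `m² ≥ 0`, `L ≥ 2`, `κ₀ = m² + min(a,(2(d+1))⁻¹) − (d+1)d²ε₀² > 0`): (1) small curvature `‖P_U − 1‖ ≤ ε₀∕L²` ⟹ `‖blk G(U) x y‖ ≤ (2∕κ₀)e^{−ctRate(κ₀)·d(x,y)∕L}`
AND `‖blk Δ_eff(U) y y′‖ ≤ (a + a²(2∕κ₀)e²)e^{−ctRate(κ₀)·d_M(y,y′)}`; (2) every pure gauge ⟹ the tree's `U ≡ 1` constants `(2∕γ_A, κ_A)` for `G` and `(C_Δ, κ_A)` for `Δ_eff`; (3) two unitary fields with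
`‖U_b − V_b‖ ≤ ε`, both `A₀` `κ`-coercive ⟹ `‖G(U) − G(V)‖ ≤ 2√(d+1)(Lε)∕(κ√κ) + 2(d+1)((Lε)² + aLε)∕κ²`.  ★★★ **`king_B9_thm31_objects_what_the_curved_case_adds`** — the massless version: at
`U ≡ 1` nothing is lost (tree constants), at a rough `U` the decay survives with `L`-dependent constants (PART Ϧ-d), on the (3.35)-class everything is `η`-uniform again and moreover STABLE:
`η`-uniformly Lipschitz in `U` on the scale `εη`.
PRIOR TREE ART (by name): Ϧ-c (`ctRate`), Ϧ-d (`norm_blk_fullOpU_inv_le_of_small_curvature`, `…_massless_of_small_curvature`, `…_pureGauge`, `…_every_U_kingComb`), Ϧ-e (`norm_blk_effLapU_le_of_small_curvature`,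
`norm_blk_effLapU_le_pureGauge`), Ϧ-h (`l2_opNorm_fullOpU_inv_sub_le_king`), `King1986.Torus` (`gamA`, `kapA`, `CDelta`).  Dedup (rg at filing): basename 0 files; needles `king_combes_thomas_package|
king_B9_thm31_objects_what_the_curved_case_adds` 0 tree files.  Locators: [Balaban1985BackgroundPropagators] Thm 3.1 p.397, (3.35)–(3.37) p.396, (3.48)–(3.50) pp.398–400; [King1986] (4.33)–(4.34) p.674;
[Dimock2013] App. D Lemmas 29–30.  0 `sorry`, 0 `def`.
-/

noncomputable section
open scoped BigOperators ComplexConjugate ComplexOrder InnerProductSpace Matrix.Norms.L2Operator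
open Finset Matrix WithLp

namespace Summit.QuantumFields.YangMills.BalabanUVNodes.N15KingModelRung.CombesThomas

open Literature.MathematicalPhysics.QuantumFieldTheory.LatticeDiamagneticInequality (blk)
open Literature.MathematicalPhysics.QuantumFieldTheory.Balaban1983to89.B5Prop11Plancherel (Tor fine)
open Literature.MathematicalPhysics.QuantumFieldTheory.King1986.Torus (blockOf tdistT gamA kapA CDelta)
open Summit.QuantumFields.YangMills.BalabanUVNodes.N15KingModelRung.Covariant (kingGaugeAct fib)
open Summit.QuantumFields.YangMills.BalabanUVNodes.N15KingModelRung.Cover (kingPlaq)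
open Summit.QuantumFields.YangMills.BalabanUVNodes.N15KingModelRung.CovariantBlock (kingComb covQ fullOpU effLapU treeGap)

variable {d : ℕ} {L : ℕ} [NeZero L] (M : Fin (d + 1) → ℕ) [hM : ∀ μ, NeZero (M μ)]
variable {𝕜 : Type*} [RCLike 𝕜] {n : Type*} [Fintype n] [DecidableEq n]

/-- ★★★ **THE COMBES–THOMAS PACKAGE OF KING's ONE-LEVEL BACKGROUND PROPAGATOR, BY NAME** (comb contours, King's scaling, `a > 0`, `m² ≥ 0`, `L ≥ 2`, `κ₀ > 0`): (1) SMALL CURVATURE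
`‖P_U − 1‖ ≤ ε₀∕L²` ⟹ `η`-uniform decay of `G(U)` AND of `Δ_eff(U)`; (2) EVERY PURE GAUGE ⟹ the tree's `U ≡ 1` constants for `G` (`2∕γ_A`, `κ_A`) and for `Δ_eff` (`C_Δ`, `κ_A`); (3) two unitary fields
at bondwise distance `ε`, both `A₀` `κ`-coercive ⟹ `‖G(U) − G(V)‖ ≤ 2√(d+1)(Lε)∕(κ√κ) + 2(d+1)((Lε)² + aLε)∕κ²`.
[cite: Balaban1985BackgroundPropagators, Thm 3.1 p.397, (3.35) p.396, (3.48)–(3.50) pp.398–400; King1986, (4.33)–(4.34) p.674; Dimock2013, App. D, Lemmas 29–30] -/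
theorem king_combes_thomas_package (hL : 2 ≤ L) {a m2 : ℝ} (ha : 0 < a) (hm : 0 ≤ m2) {ε₀ : ℝ}
    (hκ₀ : 0 < m2 + min a (1 / (2 * ((d : ℝ) + 1))) - ((d : ℝ) + 1) * (d : ℝ) ^ 2 * ε₀ ^ 2) :
    (∀ (U : Tor (fine L M) × Fin (d + 1) → Matrix n n 𝕜), (∀ bd, U bd ∈ Matrix.unitaryGroup n 𝕜) →
        (∀ (x : Tor (fine L M)) (κ ρ : Fin (d + 1)), ‖kingPlaq (fine L M) U x κ ρ - 1‖ ≤ ε₀ / (L : ℝ) ^ 2) →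
          (∀ x y : Tor (fine L M), ‖blk (fullOpU (kingComb d L) M a ((L : ℝ) ^ 2) m2 U)⁻¹ x y‖
              ≤ 2 / (m2 + min a (1 / (2 * ((d : ℝ) + 1))) - ((d : ℝ) + 1) * (d : ℝ) ^ 2 * ε₀ ^ 2)
                * Real.exp (-(ctRate (m2 + min a (1 / (2 * ((d : ℝ) + 1))) - ((d : ℝ) + 1) * (d : ℝ) ^ 2 * ε₀ ^ 2) a d / L * tdistT (fine L M) x y)))
          ∧ (∀ y y' : Tor M, ‖blk (effLapU (kingComb d L) M a ((L : ℝ) ^ 2) m2 U) y y'‖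
              ≤ (a + a ^ 2 * (2 / (m2 + min a (1 / (2 * ((d : ℝ) + 1))) - ((d : ℝ) + 1) * (d : ℝ) ^ 2 * ε₀ ^ 2)) * Real.exp 2)
                * Real.exp (-(ctRate (m2 + min a (1 / (2 * ((d : ℝ) + 1))) - ((d : ℝ) + 1) * (d : ℝ) ^ 2 * ε₀ ^ 2) a d * tdistT M y y'))))
      ∧ (∀ (g : Tor (fine L M) → Matrix n n 𝕜), (∀ x, g x ∈ Matrix.unitaryGroup n 𝕜) →
          (∀ x y : Tor (fine L M), ‖blk (fullOpU (kingComb d L) M a ((L : ℝ) ^ 2) m2 (kingGaugeAct (fine L M) g fun _ => (1 : Matrix n n 𝕜)))⁻¹ x y‖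
              ≤ 2 / gamA a (d + 1) * Real.exp (-(kapA a (d + 1) / L * tdistT (fine L M) x y)))
          ∧ (∀ y y' : Tor M, ‖blk (effLapU (kingComb d L) M a ((L : ℝ) ^ 2) m2 (kingGaugeAct (fine L M) g fun _ => (1 : Matrix n n 𝕜))) y y'‖
              ≤ CDelta a (d + 1) * Real.exp (-(kapA a (d + 1) * tdistT M y y'))))
      ∧ (∀ (U V : Tor (fine L M) × Fin (d + 1) → Matrix n n 𝕜), (∀ bd, U bd ∈ Matrix.unitaryGroup n 𝕜) → (∀ bd, V bd ∈ Matrix.unitaryGroup n 𝕜) →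
          ∀ {ε : ℝ}, 0 ≤ ε → (∀ bd, ‖U bd - V bd‖ ≤ ε) → ∀ {κ : ℝ}, 0 < κ →
            (∀ v : Tor (fine L M) × n → 𝕜, κ * ∑ x, ‖fib (fine L M) v x‖ ^ 2 ≤ RCLike.re (star v ⬝ᵥ (fullOpU (kingComb d L) M a ((L : ℝ) ^ 2) m2 U *ᵥ v))) →
            (∀ v : Tor (fine L M) × n → 𝕜, κ * ∑ x, ‖fib (fine L M) v x‖ ^ 2 ≤ RCLike.re (star v ⬝ᵥ (fullOpU (kingComb d L) M a ((L : ℝ) ^ 2) m2 V *ᵥ v))) →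
              ‖(fullOpU (kingComb d L) M a ((L : ℝ) ^ 2) m2 U)⁻¹ - (fullOpU (kingComb d L) M a ((L : ℝ) ^ 2) m2 V)⁻¹‖
                ≤ 2 * Real.sqrt ((d : ℝ) + 1) * ((L : ℝ) * ε) / (κ * Real.sqrt κ) + 2 * ((d : ℝ) + 1) * (((L : ℝ) * ε) ^ 2 + a * ((L : ℝ) * ε)) / κ ^ 2) :=
  ⟨fun U hU hε => ⟨fun x y => norm_blk_fullOpU_inv_le_of_small_curvature M hL ha.le m2 hU hε hκ₀ x y,
      fun y y' => norm_blk_effLapU_le_of_small_curvature M hL ha.le m2 hU hε hκ₀ y y'⟩,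
    fun g hg => ⟨fun x y => norm_blk_fullOpU_inv_le_pureGauge M (kingComb d L) (by omega) ha hm hg x y,
      fun y y' => norm_blk_effLapU_le_pureGauge (kingComb d L) M (by omega) ha hm hg y y'⟩,
    fun U V hU hV ε hε0 hε κ hκ hcoU hcoV => l2_opNorm_fullOpU_inv_sub_le_king (kingComb d L) M ha.le hm hU hV hε0 hε hκ hcoU hcoV rfl rfl⟩

/-- ★★★ **WHAT THE CURVED CASE ADDS FOR [B9] THEOREM 3.1's OBJECTS, BY NAME** (massless, `a > 0`, comb, `L ≥ 2`, `(d+1)d²ε₀² < min(a,(2(d+1))⁻¹)`): (a) at every pure gauge the massless full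
propagator decays with the tree's `U ≡ 1` constants; (b) at EVERY unitary `U` it still exists and decays, with the `L`-dependent tree-gauge floor; (c) on the small-curvature class the decay is
`η`-uniform again; (d) and it is STABLE there: two `κ`-coercive fields at bondwise distance `ε` have propagators within `2√(d+1)(Lε)∕(κ√κ) + 2(d+1)((Lε)² + aLε)∕κ²` in operator norm — Lipschitz on
the scale `εη`, uniformly in the spacing. [cite: Balaban1985BackgroundPropagators, Thm 3.1 p.397, (3.35)–(3.37) p.396, (3.48)–(3.50) pp.398–400; King1986, (4.33) p.674] -/
theorem king_B9_thm31_objects_what_the_curved_case_adds (hL : 2 ≤ L) {a : ℝ} (ha : 0 < a) {ε₀ : ℝ} (hsmall : ((d : ℝ) + 1) * (d : ℝ) ^ 2 * ε₀ ^ 2 < min a (1 / (2 * ((d : ℝ) + 1)))) :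
    (∀ (g : Tor (fine L M) → Matrix n n 𝕜), (∀ x, g x ∈ Matrix.unitaryGroup n 𝕜) → ∀ x y : Tor (fine L M),
          ‖blk (fullOpU (kingComb d L) M a ((L : ℝ) ^ 2) 0 (kingGaugeAct (fine L M) g fun _ => (1 : Matrix n n 𝕜)))⁻¹ x y‖
            ≤ 2 / gamA a (d + 1) * Real.exp (-(kapA a (d + 1) / L * tdistT (fine L M) x y)))
      ∧ (∀ (U : Tor (fine L M) × Fin (d + 1) → Matrix n n 𝕜), (∀ bd, U bd ∈ Matrix.unitaryGroup n 𝕜) → ∀ x y : Tor (fine L M),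
          ‖blk (fullOpU (kingComb d L) M a ((L : ℝ) ^ 2) 0 U)⁻¹ x y‖
            ≤ 2 / (0 + treeGap a ((L : ℝ) ^ 2) L d ((d + 1) * (L - 1)))
              * Real.exp (-(ctRate (0 + treeGap a ((L : ℝ) ^ 2) L d ((d + 1) * (L - 1))) a d / L * tdistT (fine L M) x y)))
      ∧ (∀ (U : Tor (fine L M) × Fin (d + 1) → Matrix n n 𝕜), (∀ bd, U bd ∈ Matrix.unitaryGroup n 𝕜) →
          (∀ (x : Tor (fine L M)) (κ ρ : Fin (d + 1)), ‖kingPlaq (fine L M) U x κ ρ - 1‖ ≤ ε₀ / (L : ℝ) ^ 2) → ∀ x y : Tor (fine L M),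
          ‖blk (fullOpU (kingComb d L) M a ((L : ℝ) ^ 2) 0 U)⁻¹ x y‖
            ≤ 2 / (min a (1 / (2 * ((d : ℝ) + 1))) - ((d : ℝ) + 1) * (d : ℝ) ^ 2 * ε₀ ^ 2)
              * Real.exp (-(ctRate (min a (1 / (2 * ((d : ℝ) + 1))) - ((d : ℝ) + 1) * (d : ℝ) ^ 2 * ε₀ ^ 2) a d / L * tdistT (fine L M) x y)))
      ∧ (∀ (U V : Tor (fine L M) × Fin (d + 1) → Matrix n n 𝕜), (∀ bd, U bd ∈ Matrix.unitaryGroup n 𝕜) → (∀ bd, V bd ∈ Matrix.unitaryGroup n 𝕜) →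
          ∀ {ε : ℝ}, 0 ≤ ε → (∀ bd, ‖U bd - V bd‖ ≤ ε) → ∀ {κ : ℝ}, 0 < κ →
            (∀ v : Tor (fine L M) × n → 𝕜, κ * ∑ x, ‖fib (fine L M) v x‖ ^ 2 ≤ RCLike.re (star v ⬝ᵥ (fullOpU (kingComb d L) M a ((L : ℝ) ^ 2) 0 U *ᵥ v))) →
            (∀ v : Tor (fine L M) × n → 𝕜, κ * ∑ x, ‖fib (fine L M) v x‖ ^ 2 ≤ RCLike.re (star v ⬝ᵥ (fullOpU (kingComb d L) M a ((L : ℝ) ^ 2) 0 V *ᵥ v))) →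
              ‖(fullOpU (kingComb d L) M a ((L : ℝ) ^ 2) 0 U)⁻¹ - (fullOpU (kingComb d L) M a ((L : ℝ) ^ 2) 0 V)⁻¹‖
                ≤ 2 * Real.sqrt ((d : ℝ) + 1) * ((L : ℝ) * ε) / (κ * Real.sqrt κ) + 2 * ((d : ℝ) + 1) * (((L : ℝ) * ε) ^ 2 + a * ((L : ℝ) * ε)) / κ ^ 2) := by
  obtain ⟨h1, h2, h3⟩ := king_B9_thm31_what_the_curved_case_adds M (𝕜 := 𝕜) (n := n) hL ha hsmall
  exact ⟨h1, h2, h3, fun U V hU hV ε hε0 hε κ hκ hcoU hcoV => l2_opNorm_fullOpU_inv_sub_le_king (kingComb d L) M ha.le le_rfl hU hV hε0 hε hκ hcoU hcoV rfl rfl⟩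

end Summit.QuantumFields.YangMills.BalabanUVNodes.N15KingModelRung.CombesThomas

end
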